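/-
Copyright (c) 2026 the pub-hodgecm-mathlib formalisation cell (harness21).  Prover seat hodgecm-mathlib-K2E3-p23 (g6), HCML Track B «K2-LIT» ∕ h413
(`stmt-HodgeConjecture-24833`), line `K2_E3_EllipticInputs`, road «GL₂-sc» (road owner K2E5-p17 (g5), dealer K2E3-plan (g4)), NON-ELLIPTIC half, brick 2N-4,
FILE 2 OF 3: the `Fin 2` twin of ★ (C-shell A) `K2E3GL3CuspFormCancellationShell` (K2E3-p21 (g5)) — descent of Theorem 20 from the level `GL₂(𝒪)` upstairs in `GL₂(F)`
to the shells `Ω n ∖ Ω R` of `G' = GL₂(F) ⧸ ϖ^ℤ·1` (the `hcanc` conjunct of ★ ASM-core `nonEllEstimates_of_radius`).  2026-09-04.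
-/
import Summits.HodgeConjecture.HodgeConjecture.Theorems.K2E3GL2ModCocompactUnimodular              -- ★ (2F-b′) p858798 (K2E5-p17 g5): `isCompact_kLambda`, `isOpen_kLambda`, `isMulRightInvariant_quotScalar_of_isHaarMeasure`; brings ★ (2F-a)∕(2F-b)
import Summits.HodgeConjecture.HodgeConjecture.Theorems.K2E3GL2SupercuspidalTwistDescent             -- ★ (2F-c) p858779 (K2E5-p17 g5): `det_scalar_eq_pow` (`det(c·1) = c²`)
import Summits.HodgeConjecture.HodgeConjecture.Theorems.K2E3GL3ModUniformizerCocompact               -- ★ B0z (K2E3-p23 g5), generic: `isClosed_zpowers_uniformizer`, `v_units_zpow_uniformizer`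
import Summits.HodgeConjecture.HodgeConjecture.Theorems.K2E3CharLocIntNearCoveringTransport         -- brings ★ B0b `K2E3CoveringHomLocalHaar` (`exists_map_restrict_smul_eq`, `setIntegral_comp_eq_of_map_restrict_eq`), generic
import Summits.HodgeConjecture.HodgeConjecture.Theorems.K2E3RightInvariantSetIntegralVanishing      -- ★ f1 (K2E3-p14 g3): `setIntegral_eq_zero_of_forall_setIntegral_mul_eq_zero`, generic
import Literature.NumberTheory.Automorphic.ValuedFieldValuativeRelBridge                            -- ★ `valuation_det_eq_one_of_mem_glInt`, `v_eq_one_iff_valuation_eq_one`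
import HarnessLib

/-!
# Road «GL₂-sc», non-elliptic half, brick 2N-4 (file 2 of 3) — descent of Theorem 20 from `GL₂(𝒪) ⊆ GL₂(F)` to the shells `Ω n ∖ Ω R` of `G' = GL₂(F) ⧸ ϖ^ℤ·1`

Cell `pub/hodgecm-mathlib` (D-0151), Track B «K2-LIT», crux H413 = `stmt-HodgeConjecture-24833`, route of record `HCCMUnconditional`.  Lane
`--supports stmt-HodgeConjecture-24833 --as helper`; THEOREMS ONLY (no `def`, no `instance`, no `notation`, no named-fact hypothesis, no `sorry`); count-neutral.
`Fin 2` reading of ★ (C-shell A) (K2E3-p21 (g5), road «GL-[M6]-sc»).  CONSUMED INPUT = ★ T20₂ `cuspForm_cancellation_GL2_split` (this seat):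
`… (hx : ¬ 𝔅_R(x)) : ∫ k in ↑(glInt 2 F), f (x * k * y) ∂μ = 0` UPSTAIRS.  OUTPUT = the SHELL statements DOWNSTAIRS on `G'` for any Haar `μ'` and any compact exhaustion `Ω`
with ★ 2N-0a's `hmem`∕`hK` (taken as hypotheses on an abstract `Ω : CompactExhaustion G'`), for a continuous `F' : G' → E` resp. the conjugation slice `F' x̄ = θ(x̄ ḡ x̄⁻¹)`,
`ḡ = mk (y γ y⁻¹)`, `f z = θ(mk(z γ z⁻¹))`.  [HarishChandra1970, Part VII §3 p. 71 eq. (1), p. 72; §2 Thm 20 p. 70]; [WeilBNT1967, Ch. II §5]; [Folland1995, §2.6].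
* §0 `eq_one_of_mem_glInt_of_mk_eq_one` — `GL₂(𝒪) ∩ ϖ^ℤ·1 = 1` (`det(ϖ^k·1) = ϖ^{2k}`).
* §1 **`setIntegral_kLambda_eq_zero_of_setIntegral_glInt_eq_zero`** — `mk : GL₂(𝒪) ≅ K_Λ`, `mk_*(μ|_{K₁}) = c · μ'|_{K_Λ}` (★ B0b): `∫_{K₁} F'(mk(x k)) dμ = 0 ⇒ ∫_{K_Λ} F'(mk x · k') dμ' = 0`.
* §2 **`setIntegral_sdiff_eq_zero_of_forall_upstairs`**, **`setIntegral_eq_setIntegral_inter_of_forall_upstairs`** (★ f1 on the right-`K_Λ`-invariant shell).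
* §3 **`setIntegral_conj_eq_setIntegral_inter_of_cuspForm_cancellation`** — the `hcanc` conjunct at `ḡ = mk (y γ y⁻¹)` from the upstairs cancellation of the slice.
HONEST LABEL: HC_CM is proved only modulo the 7 printed citations (2 remaining named inputs: hLiu418 = `stmt-HodgeConjecture-24832`, h413 = `stmt-HodgeConjecture-24833`)
until rung 0 closes; count-neutral helper.

## References
* [HarishChandra1970] Harish-Chandra (notes by G. van Dijk), *Harmonic Analysis on Reductive p-adic Groups*, LNM 162 (1970), Part VII §2 Thm 20 p. 70, §3 pp. 71–72.
* [WeilBNT1967] A. Weil, *Basic Number Theory* (1967), Ch. II §5 (Haar measures and local isomorphisms).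
* [Folland1995] G. B. Folland, *A Course in Abstract Harmonic Analysis* (1995), §2.4, §2.6.
* [PlatonovRapinchuk1994] V. Platonov, A. Rapinchuk, *Algebraic Groups and Number Theory* (1994), §3.3.
-/

set_option autoImplicit false
-- the mandated namespace repeats the single-problem summit's segment (`HodgeConjecture.HodgeConjecture`)
set_option linter.dupNamespace false

noncomputable section

open MeasureTheory MeasureTheory.Measure Set Filter Topology
open scoped MatrixGroups Pointwise WithZero
open Matrix ValuativeRel
open Literature.NumberTheory.Automorphic Literature.NumberTheory.GaloisRepresentations Literature.NumberTheory.GaloisRepresentations.IsNonarchimedeanLocalField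
open Summit.HodgeConjecture.HodgeConjecture.Cruxes.H413.K2E3GL2ModCentre
open Summit.HodgeConjecture.HodgeConjecture.Cruxes.H413.K2E3GL2ModCocompactCentral
open Summit.HodgeConjecture.HodgeConjecture.Cruxes.H413.K2E3GL2ModCocompactUnimodular
open Summit.HodgeConjecture.HodgeConjecture.Cruxes.H413.K2E3GL3ModUniformizerCocompact

namespace Summit.HodgeConjecture.HodgeConjecture.Cruxes.H413.K2E3GL2CuspFormCancellationShell

variable {F : Type*} [Field F] [Valued F ℤᵐ⁰] [ValuativeRel F] [(Valued.v : Valuation F ℤᵐ⁰).Compatible] [IsNonarchimedeanLocalField F]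
  {ϖ : F} (hϖ : Valued.v ϖ = WithZero.exp (-1 : ℤ)) (hϖ0 : ϖ ≠ 0)
  [((Subgroup.zpowers (Units.mk0 ϖ hϖ0)).map (Matrix.GeneralLinearGroup.scalar (Fin 2))).Normal]
  [MeasurableSpace (GL (Fin 2) F)] [BorelSpace (GL (Fin 2) F)]
  [MeasurableSpace (GL (Fin 2) F ⧸ (Subgroup.zpowers (Units.mk0 ϖ hϖ0)).map (Matrix.GeneralLinearGroup.scalar (Fin 2)))]
  [BorelSpace (GL (Fin 2) F ⧸ (Subgroup.zpowers (Units.mk0 ϖ hϖ0)).map (Matrix.GeneralLinearGroup.scalar (Fin 2)))]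
  (μ : Measure (GL (Fin 2) F)) [μ.IsHaarMeasure]
  (μ' : Measure (GL (Fin 2) F ⧸ (Subgroup.zpowers (Units.mk0 ϖ hϖ0)).map (Matrix.GeneralLinearGroup.scalar (Fin 2)))) [μ'.IsHaarMeasure]
  {E : Type*} [NormedAddCommGroup E] [NormedSpace ℝ E] [CompleteSpace E]

/-! ## §0  `GL₂(𝒪) ∩ ϖ^ℤ·1 = 1` -/

omit [IsNonarchimedeanLocalField F] [MeasurableSpace (GL (Fin 2) F)] [BorelSpace (GL (Fin 2) F)]
  [MeasurableSpace (GL (Fin 2) F ⧸ (Subgroup.zpowers (Units.mk0 ϖ hϖ0)).map (Matrix.GeneralLinearGroup.scalar (Fin 2)))]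
  [BorelSpace (GL (Fin 2) F ⧸ (Subgroup.zpowers (Units.mk0 ϖ hϖ0)).map (Matrix.GeneralLinearGroup.scalar (Fin 2)))] in
include hϖ in
/-- **`GL₂(𝒪) ∩ ϖ^ℤ·1 = 1`**: an element of `GL₂(𝒪)` that dies in `GL₂(F) ⧸ ϖ^ℤ·1` is `1` (`det (ϖ^k·1) = ϖ^{2k}` is a unit only for `k = 0`) — the discreteness input
`hker` of ★ B0b `exists_map_restrict_smul_eq`. [cite: PlatonovRapinchuk1994, §3.3] -/
theorem eq_one_of_mem_glInt_of_mk_eq_one {x : GL (Fin 2) F} (hx : x ∈ glInt 2 F)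
    (h1 : (QuotientGroup.mk x : GL (Fin 2) F ⧸ (Subgroup.zpowers (Units.mk0 ϖ hϖ0)).map (Matrix.GeneralLinearGroup.scalar (Fin 2))) = 1) : x = 1 := by
  rw [QuotientGroup.eq_one_iff] at h1
  obtain ⟨u, hu, rfl⟩ := Subgroup.mem_map.1 h1
  obtain ⟨k, rfl⟩ := Subgroup.mem_zpowers_iff.1 hu
  have hdet := valuation_det_eq_one_of_mem_glInt hx
  rw [← v_eq_one_iff_valuation_eq_one, ← Matrix.GeneralLinearGroup.val_det_apply, K2E3GL2SupercuspidalTwistDescent.det_scalar_eq_pow, ← zpow_natCast, ← _root_.zpow_mul,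
    v_units_zpow_uniformizer hϖ hϖ0, WithZero.exp_eq_one, neg_eq_zero] at hdet
  have hk : k = 0 := by
    have h2 : k * ((2 : ℕ) : ℤ) = 0 := hdet
    simpa using h2
  subst hk
  rw [zpow_zero, map_one]

/-! ## §1  The level: `∫_{GL₂(𝒪)} F'(mk(x k)) dμ = 0 ⇒ ∫_{K_Λ} F'(mk x · k') dμ' = 0` -/

omit [CompleteSpace E] in
include hϖ in
/-- **LEVEL DESCENT.**  `GL₂(𝒪) ∩ ϖ^ℤ·1 = 1`, so the quotient map restricts to an isomorphism `GL₂(𝒪) ≅ K_Λ = mk(GL₂(𝒪))` carrying `μ|_{GL₂(𝒪)}` to `c·μ'|_{K_Λ}`, `c > 0` (★ B0b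
`exists_map_restrict_smul_eq`); hence `∫_{GL₂(𝒪)} F'(mk(x k)) dμ(k) = 0` implies `∫_{K_Λ} F'(mk x · k') dμ'(k') = 0` for continuous `F'`. [cite: WeilBNT1967, Ch. II §5]
[cite: HarishChandra1970, Part VII §3 p. 71] -/
theorem setIntegral_kLambda_eq_zero_of_setIntegral_glInt_eq_zero
    (F' : GL (Fin 2) F ⧸ (Subgroup.zpowers (Units.mk0 ϖ hϖ0)).map (Matrix.GeneralLinearGroup.scalar (Fin 2)) → E) (hF' : Continuous F') (x : GL (Fin 2) F)
    (h : ∫ k in (glInt 2 F : Set (GL (Fin 2) F)),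
      F' (QuotientGroup.mk (x * k) : GL (Fin 2) F ⧸ (Subgroup.zpowers (Units.mk0 ϖ hϖ0)).map (Matrix.GeneralLinearGroup.scalar (Fin 2))) ∂μ = 0) :
    ∫ k' in (((glInt 2 F).map (QuotientGroup.mk' ((Subgroup.zpowers (Units.mk0 ϖ hϖ0)).map (Matrix.GeneralLinearGroup.scalar (Fin 2))))) :
        Set (GL (Fin 2) F ⧸ (Subgroup.zpowers (Units.mk0 ϖ hϖ0)).map (Matrix.GeneralLinearGroup.scalar (Fin 2)))),
      F' ((QuotientGroup.mk x : GL (Fin 2) F ⧸ (Subgroup.zpowers (Units.mk0 ϖ hϖ0)).map (Matrix.GeneralLinearGroup.scalar (Fin 2))) * k') ∂μ' = 0 := by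
  haveI : SecondCountableTopology (GL (Fin 2) F) := secondCountableTopology_gl2 F
  haveI : LocallyCompactSpace (GL (Fin 2) F) := locallyCompactSpace_gl2 F
  obtain ⟨c, hc, hmap⟩ := K2E3CoveringHomLocalHaar.exists_map_restrict_smul_eq (QuotientGroup.mk' ((Subgroup.zpowers (Units.mk0 ϖ hϖ0)).map (Matrix.GeneralLinearGroup.scalar (Fin 2)))) QuotientGroup.continuous_mk
    QuotientGroup.isOpenMap_coe (glInt 2 F) (isOpen_glInt 2 F) (fun k hk h1 => eq_one_of_mem_glInt_of_mk_eq_one hϖ hϖ0 hk h1) μ μ'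
  have key := K2E3CoveringHomLocalHaar.setIntegral_comp_eq_of_map_restrict_eq (p := QuotientGroup.mk' ((Subgroup.zpowers (Units.mk0 ϖ hϖ0)).map (Matrix.GeneralLinearGroup.scalar (Fin 2)))) (g := (1 : GL (Fin 2) F))
    QuotientGroup.continuous_mk.measurable (hmap 1)
    (fun k' => F' ((QuotientGroup.mk x : GL (Fin 2) F ⧸ ((Subgroup.zpowers (Units.mk0 ϖ hϖ0)).map (Matrix.GeneralLinearGroup.scalar (Fin 2)))) * k')) ((hF'.comp (continuous_const.mul continuous_id)).aestronglyMeasurable)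
  rw [one_smul, map_one, one_smul, QuotientGroup.coe_mk'] at key
  have hfun : (fun k : GL (Fin 2) F => F' ((QuotientGroup.mk x : GL (Fin 2) F ⧸ ((Subgroup.zpowers (Units.mk0 ϖ hϖ0)).map (Matrix.GeneralLinearGroup.scalar (Fin 2)))) * (QuotientGroup.mk k : GL (Fin 2) F ⧸ ((Subgroup.zpowers (Units.mk0 ϖ hϖ0)).map (Matrix.GeneralLinearGroup.scalar (Fin 2)))))) =
      fun k : GL (Fin 2) F => F' (QuotientGroup.mk (x * k) : GL (Fin 2) F ⧸ ((Subgroup.zpowers (Units.mk0 ϖ hϖ0)).map (Matrix.GeneralLinearGroup.scalar (Fin 2)))) := by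
    funext k
    rw [← QuotientGroup.mk_mul]
  rw [hfun, h] at key
  rw [Subgroup.coe_map, QuotientGroup.coe_mk']
  rcases smul_eq_zero.1 key.symm with h0 | h0
  · exact absurd h0 hc.ne'
  · exact h0

/-! ## §2  The shells of `G'` -/

include hϖ in
/-- **SHELL VANISHING FROM THE UPSTAIRS LEVEL STATEMENTS.**  Let `Ω` be a compact exhaustion of `G'` whose balls have p14's membership (`hmem`) and are bi-invariant under
`K_Λ` (`hK`), `μ, μ'` Haar measures, `F'` continuous.  If `∫_{GL₂(𝒪)} F'(mk(x k)) dμ(k) = 0` for every `x` with `¬ 𝔅_R(x)`, then `∫_{Ω n ∖ Ω R} F' dμ' = 0` for every `n`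
(§1 at each point of the right-`K_Λ`-invariant shell + ★ `setIntegral_eq_zero_of_forall_setIntegral_mul_eq_zero`). [cite: HarishChandra1970, Part VII §3 p. 71 eq. (1)]
[cite: Folland1995, §2.6] -/
theorem setIntegral_sdiff_eq_zero_of_forall_upstairs
    (Ω : CompactExhaustion (GL (Fin 2) F ⧸ (Subgroup.zpowers (Units.mk0 ϖ hϖ0)).map (Matrix.GeneralLinearGroup.scalar (Fin 2))))
    (hmem : ∀ (m : ℕ) (g : GL (Fin 2) F),
      (QuotientGroup.mk g : GL (Fin 2) F ⧸ (Subgroup.zpowers (Units.mk0 ϖ hϖ0)).map (Matrix.GeneralLinearGroup.scalar (Fin 2))) ∈ Ω m ↔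
        ∀ i j k l, Valued.v (ϖ ^ m * ((g : Matrix (Fin 2) (Fin 2) F) i j * ((g⁻¹ : GL (Fin 2) F) : Matrix (Fin 2) (Fin 2) F) k l)) ≤ 1)
    (hK : ∀ (m : ℕ) (k : GL (Fin 2) F), k ∈ glInt 2 F → ∀ x : GL (Fin 2) F ⧸ (Subgroup.zpowers (Units.mk0 ϖ hϖ0)).map (Matrix.GeneralLinearGroup.scalar (Fin 2)),
      ((QuotientGroup.mk k : GL (Fin 2) F ⧸ _) * x ∈ Ω m ↔ x ∈ Ω m) ∧ (x * (QuotientGroup.mk k : GL (Fin 2) F ⧸ _) ∈ Ω m ↔ x ∈ Ω m))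
    (F' : GL (Fin 2) F ⧸ (Subgroup.zpowers (Units.mk0 ϖ hϖ0)).map (Matrix.GeneralLinearGroup.scalar (Fin 2)) → E) (hF' : Continuous F') {R : ℕ}
    (h : ∀ x : GL (Fin 2) F, ¬ (∀ i j k l, Valued.v (ϖ ^ R * ((x : Matrix (Fin 2) (Fin 2) F) i j * ((x⁻¹ : GL (Fin 2) F) : Matrix (Fin 2) (Fin 2) F) k l)) ≤ 1) →
      ∫ k in (glInt 2 F : Set (GL (Fin 2) F)),
        F' (QuotientGroup.mk (x * k) : GL (Fin 2) F ⧸ (Subgroup.zpowers (Units.mk0 ϖ hϖ0)).map (Matrix.GeneralLinearGroup.scalar (Fin 2))) ∂μ = 0)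
    (n : ℕ) : ∫ x in Ω n \ Ω R, F' x ∂μ' = 0 := by
  haveI : SecondCountableTopology (GL (Fin 2) F) := secondCountableTopology_gl2 F
  haveI : LocallyCompactSpace (GL (Fin 2) F) := locallyCompactSpace_gl2 F
  have hΛ : IsClosed ((Subgroup.zpowers (Units.mk0 ϖ hϖ0) : Subgroup Fˣ) : Set Fˣ) := isClosed_zpowers_uniformizer hϖ hϖ0
  haveI : T2Space (GL (Fin 2) F ⧸ ((Subgroup.zpowers (Units.mk0 ϖ hϖ0)).map (Matrix.GeneralLinearGroup.scalar (Fin 2)))) := t2Space_quotScalar _ hΛ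
  haveI : μ'.IsMulRightInvariant := isMulRightInvariant_quotScalar_of_isHaarMeasure _ hΛ hϖ μ'
  -- the compact open level `K_Λ`
  have hKc : IsCompact (((glInt 2 F).map (QuotientGroup.mk' ((Subgroup.zpowers (Units.mk0 ϖ hϖ0)).map (Matrix.GeneralLinearGroup.scalar (Fin 2)))) : Subgroup (GL (Fin 2) F ⧸ ((Subgroup.zpowers (Units.mk0 ϖ hϖ0)).map (Matrix.GeneralLinearGroup.scalar (Fin 2))))) : Set (GL (Fin 2) F ⧸ ((Subgroup.zpowers (Units.mk0 ϖ hϖ0)).map (Matrix.GeneralLinearGroup.scalar (Fin 2))))) := isCompact_kLambda _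
  have hKo : IsOpen (((glInt 2 F).map (QuotientGroup.mk' ((Subgroup.zpowers (Units.mk0 ϖ hϖ0)).map (Matrix.GeneralLinearGroup.scalar (Fin 2)))) : Subgroup (GL (Fin 2) F ⧸ ((Subgroup.zpowers (Units.mk0 ϖ hϖ0)).map (Matrix.GeneralLinearGroup.scalar (Fin 2))))) : Set (GL (Fin 2) F ⧸ ((Subgroup.zpowers (Units.mk0 ϖ hϖ0)).map (Matrix.GeneralLinearGroup.scalar (Fin 2))))) := isOpen_kLambda _
  have hKpos : μ' (((glInt 2 F).map (QuotientGroup.mk' ((Subgroup.zpowers (Units.mk0 ϖ hϖ0)).map (Matrix.GeneralLinearGroup.scalar (Fin 2)))) : Subgroup (GL (Fin 2) F ⧸ ((Subgroup.zpowers (Units.mk0 ϖ hϖ0)).map (Matrix.GeneralLinearGroup.scalar (Fin 2))))) : Set (GL (Fin 2) F ⧸ ((Subgroup.zpowers (Units.mk0 ϖ hϖ0)).map (Matrix.GeneralLinearGroup.scalar (Fin 2))))) ≠ 0 :=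
    hKo.measure_ne_zero μ' ⟨1, Subgroup.one_mem _⟩
  -- the shell: measurable, relatively compact, right-`K_Λ`-invariant
  have hSm : MeasurableSet (Ω n \ Ω R) := (Ω.isCompact n).measurableSet.diff (Ω.isCompact R).measurableSet
  have hSc : IsCompact (closure (Ω n \ Ω R)) := (Ω.isCompact n).closure_of_subset sdiff_subset
  have hSK : ∀ x ∈ Ω n \ Ω R, ∀ k ∈ ((glInt 2 F).map (QuotientGroup.mk' ((Subgroup.zpowers (Units.mk0 ϖ hϖ0)).map (Matrix.GeneralLinearGroup.scalar (Fin 2)))) : Subgroup (GL (Fin 2) F ⧸ ((Subgroup.zpowers (Units.mk0 ϖ hϖ0)).map (Matrix.GeneralLinearGroup.scalar (Fin 2))))), x * k ∈ Ω n \ Ω R := by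
    intro x hx k hk
    obtain ⟨k₀, hk₀, rfl⟩ := Subgroup.mem_map.1 hk
    exact ⟨((hK n k₀ hk₀ x).2).2 hx.1, fun h' => hx.2 (((hK R k₀ hk₀ x).2).1 h')⟩
  -- §1 at every point of the shell
  have h0 : ∀ x ∈ Ω n \ Ω R, ∫ k in (((glInt 2 F).map (QuotientGroup.mk' ((Subgroup.zpowers (Units.mk0 ϖ hϖ0)).map (Matrix.GeneralLinearGroup.scalar (Fin 2)))) : Subgroup (GL (Fin 2) F ⧸ ((Subgroup.zpowers (Units.mk0 ϖ hϖ0)).map (Matrix.GeneralLinearGroup.scalar (Fin 2))))) : Set (GL (Fin 2) F ⧸ ((Subgroup.zpowers (Units.mk0 ϖ hϖ0)).map (Matrix.GeneralLinearGroup.scalar (Fin 2))))),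
      F' (x * k) ∂μ' = 0 := by
    intro x hx
    obtain ⟨x₀, rfl⟩ := QuotientGroup.mk_surjective x
    have hx₀ : ¬ (∀ i j k l, Valued.v (ϖ ^ R * ((x₀ : Matrix (Fin 2) (Fin 2) F) i j * ((x₀⁻¹ : GL (Fin 2) F) : Matrix (Fin 2) (Fin 2) F) k l)) ≤ 1) :=
      fun hb => hx.2 ((hmem R x₀).2 hb)
    exact setIntegral_kLambda_eq_zero_of_setIntegral_glInt_eq_zero hϖ hϖ0 μ μ' F' hF' x₀ (h x₀ hx₀)
  exact K2E3RightInvariantSetIntegralVanishing.setIntegral_eq_zero_of_forall_setIntegral_mul_eq_zero μ' _ hKc hKpos hSm hSc hSK F' hF' h0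

include hϖ in
/-- **THE `hcanc` SHAPE**: under the hypotheses of `setIntegral_sdiff_eq_zero_of_forall_upstairs`, `∫_{Ω n} F' dμ' = ∫_{Ω n ∩ Ω R} F' dμ'` for every `n`.
[cite: HarishChandra1970, Part VII §3 p. 72] -/
theorem setIntegral_eq_setIntegral_inter_of_forall_upstairs
    (Ω : CompactExhaustion (GL (Fin 2) F ⧸ (Subgroup.zpowers (Units.mk0 ϖ hϖ0)).map (Matrix.GeneralLinearGroup.scalar (Fin 2))))
    (hmem : ∀ (m : ℕ) (g : GL (Fin 2) F),
      (QuotientGroup.mk g : GL (Fin 2) F ⧸ (Subgroup.zpowers (Units.mk0 ϖ hϖ0)).map (Matrix.GeneralLinearGroup.scalar (Fin 2))) ∈ Ω m ↔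
        ∀ i j k l, Valued.v (ϖ ^ m * ((g : Matrix (Fin 2) (Fin 2) F) i j * ((g⁻¹ : GL (Fin 2) F) : Matrix (Fin 2) (Fin 2) F) k l)) ≤ 1)
    (hK : ∀ (m : ℕ) (k : GL (Fin 2) F), k ∈ glInt 2 F → ∀ x : GL (Fin 2) F ⧸ (Subgroup.zpowers (Units.mk0 ϖ hϖ0)).map (Matrix.GeneralLinearGroup.scalar (Fin 2)),
      ((QuotientGroup.mk k : GL (Fin 2) F ⧸ _) * x ∈ Ω m ↔ x ∈ Ω m) ∧ (x * (QuotientGroup.mk k : GL (Fin 2) F ⧸ _) ∈ Ω m ↔ x ∈ Ω m))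
    (F' : GL (Fin 2) F ⧸ (Subgroup.zpowers (Units.mk0 ϖ hϖ0)).map (Matrix.GeneralLinearGroup.scalar (Fin 2)) → E) (hF' : Continuous F') {R : ℕ}
    (h : ∀ x : GL (Fin 2) F, ¬ (∀ i j k l, Valued.v (ϖ ^ R * ((x : Matrix (Fin 2) (Fin 2) F) i j * ((x⁻¹ : GL (Fin 2) F) : Matrix (Fin 2) (Fin 2) F) k l)) ≤ 1) →
      ∫ k in (glInt 2 F : Set (GL (Fin 2) F)),
        F' (QuotientGroup.mk (x * k) : GL (Fin 2) F ⧸ (Subgroup.zpowers (Units.mk0 ϖ hϖ0)).map (Matrix.GeneralLinearGroup.scalar (Fin 2))) ∂μ = 0)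
    (n : ℕ) : ∫ x in Ω n, F' x ∂μ' = ∫ x in Ω n ∩ Ω R, F' x ∂μ' := by
  haveI : SecondCountableTopology (GL (Fin 2) F) := secondCountableTopology_gl2 F
  haveI : LocallyCompactSpace (GL (Fin 2) F) := locallyCompactSpace_gl2 F
  haveI : T2Space (GL (Fin 2) F ⧸ (Subgroup.zpowers (Units.mk0 ϖ hϖ0)).map (Matrix.GeneralLinearGroup.scalar (Fin 2))) :=
    t2Space_quotScalar _ (isClosed_zpowers_uniformizer hϖ hϖ0)
  have hint : IntegrableOn F' (Ω n) μ' := hF'.continuousOn.integrableOn_compact (Ω.isCompact n)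
  rw [← integral_inter_add_sdiff (Ω.isCompact R).measurableSet hint,
    setIntegral_sdiff_eq_zero_of_forall_upstairs hϖ hϖ0 μ μ' Ω hmem hK F' hF' h n, add_zero]

/-! ## §3  The reading for (C): conjugation slices -/

include hϖ in
/-- **`hcanc` AT `ḡ = mk (y γ y⁻¹)` FROM THE UPSTAIRS CANCELLATION OF THE SLICE `f z = θ(mk(z γ z⁻¹))`.**  With (C)'s conclusion `∫_{GL₂(𝒪)} f (x k y) dμ(k) = 0` for
all `x` with `¬ 𝔅_R(x)` (K2E5-p17's `cuspForm_cancellation_GL2_split`, `f (x k y) = θ(mk((x k y) γ (x k y)⁻¹))`), for every `n`: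
`∫_{Ω n} θ(x̄ ḡ x̄⁻¹) dμ'(x̄) = ∫_{Ω n ∩ Ω R} θ(x̄ ḡ x̄⁻¹) dμ'(x̄)` — the `hcanc` conjunct of ★ ASM-core `nonEllEstimates_of_radius` at `ḡ`.
[cite: HarishChandra1970, Part VII §2 Thm 20 p. 70, §3 pp. 71–72] -/
theorem setIntegral_conj_eq_setIntegral_inter_of_cuspForm_cancellation
    (Ω : CompactExhaustion (GL (Fin 2) F ⧸ (Subgroup.zpowers (Units.mk0 ϖ hϖ0)).map (Matrix.GeneralLinearGroup.scalar (Fin 2))))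
    (hmem : ∀ (m : ℕ) (g : GL (Fin 2) F),
      (QuotientGroup.mk g : GL (Fin 2) F ⧸ (Subgroup.zpowers (Units.mk0 ϖ hϖ0)).map (Matrix.GeneralLinearGroup.scalar (Fin 2))) ∈ Ω m ↔
        ∀ i j k l, Valued.v (ϖ ^ m * ((g : Matrix (Fin 2) (Fin 2) F) i j * ((g⁻¹ : GL (Fin 2) F) : Matrix (Fin 2) (Fin 2) F) k l)) ≤ 1)
    (hK : ∀ (m : ℕ) (k : GL (Fin 2) F), k ∈ glInt 2 F → ∀ x : GL (Fin 2) F ⧸ (Subgroup.zpowers (Units.mk0 ϖ hϖ0)).map (Matrix.GeneralLinearGroup.scalar (Fin 2)),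
      ((QuotientGroup.mk k : GL (Fin 2) F ⧸ _) * x ∈ Ω m ↔ x ∈ Ω m) ∧ (x * (QuotientGroup.mk k : GL (Fin 2) F ⧸ _) ∈ Ω m ↔ x ∈ Ω m))
    (θ : GL (Fin 2) F ⧸ (Subgroup.zpowers (Units.mk0 ϖ hϖ0)).map (Matrix.GeneralLinearGroup.scalar (Fin 2)) → E) (hθ : Continuous θ)
    (γ y : GL (Fin 2) F) {R : ℕ}
    (h20 : ∀ x : GL (Fin 2) F, ¬ (∀ i j k l, Valued.v (ϖ ^ R * ((x : Matrix (Fin 2) (Fin 2) F) i j * ((x⁻¹ : GL (Fin 2) F) : Matrix (Fin 2) (Fin 2) F) k l)) ≤ 1) →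
      ∫ k in (glInt 2 F : Set (GL (Fin 2) F)),
        θ (QuotientGroup.mk ((x * k * y) * γ * (x * k * y)⁻¹) : GL (Fin 2) F ⧸ (Subgroup.zpowers (Units.mk0 ϖ hϖ0)).map (Matrix.GeneralLinearGroup.scalar (Fin 2))) ∂μ = 0)
    (n : ℕ) :
    ∫ x in Ω n, θ (x * QuotientGroup.mk (y * γ * y⁻¹) * x⁻¹) ∂μ' = ∫ x in Ω n ∩ Ω R, θ (x * QuotientGroup.mk (y * γ * y⁻¹) * x⁻¹) ∂μ' := by
  have hF' : Continuous fun x : GL (Fin 2) F ⧸ (Subgroup.zpowers (Units.mk0 ϖ hϖ0)).map (Matrix.GeneralLinearGroup.scalar (Fin 2)) =>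
      θ (x * QuotientGroup.mk (y * γ * y⁻¹) * x⁻¹) :=
    hθ.comp ((continuous_id.mul continuous_const).mul continuous_id.inv)
  refine setIntegral_eq_setIntegral_inter_of_forall_upstairs hϖ hϖ0 μ μ' Ω hmem hK _ hF' (fun x hx => ?_) n
  have heq : (fun k : GL (Fin 2) F => θ ((QuotientGroup.mk (x * k) : GL (Fin 2) F ⧸ (Subgroup.zpowers (Units.mk0 ϖ hϖ0)).map (Matrix.GeneralLinearGroup.scalar (Fin 2))) *
      QuotientGroup.mk (y * γ * y⁻¹) * (QuotientGroup.mk (x * k))⁻¹)) =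
      fun k : GL (Fin 2) F => θ (QuotientGroup.mk ((x * k * y) * γ * (x * k * y)⁻¹)) := by
    funext k
    rw [← QuotientGroup.mk_inv, ← QuotientGroup.mk_mul, ← QuotientGroup.mk_mul]
    congr 2
    group
  rw [heq]
  exact h20 x hx

end Summit.HodgeConjecture.HodgeConjecture.Cruxes.H413.K2E3GL2CuspFormCancellationShell

end
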